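/-
Copyright: the b2b-balaban T⁴-continuum CRUX team, row NE7b OWNER lineage `t4-ne7b-p1` (gen 143). Project licence.
-/
import Summits.QuantumFields.BalabanUV.T4Continuum.Spine.NE7b.SupTiltedCumulantCalculusOne

/-!
# SPLITTING CENTRED PAIRS AND QUADRUPLES INTO RAW TILTED MOMENTS (SCOPING (d15); the generic form of (519)'s splits).  For continuous observables of
# (513)'s growth class and arbitrary centring constants, `∫e(f−a)(g−b)` and `∫eΠ⁴(fᵢ−cᵢ)` are the signed sums of the raw moments `∫eΠ_{i∈S}fᵢ`
# (every sub-product is integrable by (518) `integrable_tilted_of_growth` and (581)'s class closure) — the bookkeeping the cumulant rules 3 and 4 use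
# to read their CENTRED targets (`κ₃ᶜ`, `u₄`, `u₅`) in raw moments (row NE7b, node U5c; (581), (518) BY NAME; [folklore])

Cell `pub-balaban`, sub-cell `t4`, spine estimate NE7b (`T4WeightBudget.RelWeightBound`; the cell's OWN estimate — NOT PRINTED in
[Bałaban 1983–89], NOT PROVED).  Crux-route work under `Spine/NE7b/` by the row OWNER (`t4-ne7b-p1` gen 143, file (582)) under FREEZE
(0)'s crux-prover clause; NOTHING of Bałaban's is named as a Lean object, valued or asserted; no `T4Continuum/Support` leaf typed; no
`def`, no notation; zero `sorry`.  Imports (BY NAME): the OWNER's (581) `…SupTiltedCumulantCalculusOne` (`class_mul_abs_le`; through it (518)).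

WHAT IS PROVED ([folklore]): **`split_centred_pair`**, **`split_centred_quad`**; toy.

HONEST (what this is NOT).  Integral bookkeeping only.  Scalar skeleton ((A3), NC-NE7b-α UNRULED); nothing of Bałaban's asserted.  BY-NAME EFFECT ON
THE WALL: NONE.  NE7b NOT PRINTED ∕ NOT PROVED; spine PROVED 0∕9; rung (B)+1 — the programme's measures remain FINITE-torus statements; NOT the mass
gap, NOT Clay.  HONEST DEPENDENCY: continuum YM on T⁴ ⇐ BetaPertH ∧ nine spine estimates (0∕9 proved); BetaPertH ⇐ (D1) ∧ (D4) ∧ CAP+tail; G-an2-4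
gates asym, D1 and NE2∕3∕4.
-/

set_option autoImplicit false
set_option maxSynthPendingDepth 3

noncomputable section

namespace Summit.QuantumFields.BalabanUV.T4Continuum.NE7b.SupTiltedCentredSplits

open MeasureTheory ProbabilityTheory Real Set Function Finset Matrix
open scoped BigOperators
open SupFourthOrderMonomials (integrable_tilted_of_growth)
open SupTiltedCumulantCalculusOne (class_mul_abs_le)

variable {ι : Type} [Fintype ι] [DecidableEq ι]

variable {Γ : Matrix ι ι ℝ} {γop : ℝ} {U : EuclideanSpace ℝ ι → ℝ} {U' : EuclideanSpace ℝ ι → EuclideanSpace ℝ ι →L[ℝ] ℝ} {κ₀ κ₁ a τ δ θ : ℝ}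

/-- **Splitting a centred pair**: `∫e(f−a)(g−b) = ∫efg − a∫eg − b∫ef + ab·Z`. [folklore] -/
theorem split_centred_pair {f g : EuclideanSpace ℝ ι → ℝ} {Cf Cg : ℝ} {nf ng : ℕ} (hΓ : Γ.PosSemidef) (hΓop : (γop • (1 : Matrix ι ι ℝ) -
    Γ).PosSemidef)
    (Y : Finset ι) (hUd : ∀ φ : EuclideanSpace ℝ ι, HasFDerivAt U (U' φ) φ)
    (hκ₀ : 0 ≤ κ₀) (hκ₁ : 0 ≤ κ₁) (ha : 0 ≤ a) (hτ : 0 < τ) (hδ : 0 < δ) (hθ1 : θ < 1) (hκθ : (2 * κ₀ * (1 + τ) + 4 * δ) * γop ≤ θ)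
    (hstab : ∀ φ : EuclideanSpace ℝ ι, -(κ₀ * ∑ x ∈ Y, φ x ^ 2) ≤ U φ) (hU'b : ∀ φ : EuclideanSpace ℝ ι, ‖U' φ‖ ≤ κ₁ * (a + ∑ x ∈ Y, φ x ^ 2))
    (hfc : Continuous f) (hfb : ∀ φ : EuclideanSpace ℝ ι, |f φ| ≤ Cf * (1 + ‖U' φ‖) ^ nf) (hgc : Continuous g) (hgb : ∀ φ : EuclideanSpace ℝ ι, |g φ|
        ≤ Cg * (1 + ‖U' φ‖) ^ ng)
    (ψ : EuclideanSpace ℝ ι) (ca cb : ℝ) :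
    (∫ ω : EuclideanSpace ℝ ι, exp (-U (ω + ψ)) * ((f (ω + ψ) - ca) * (g (ω + ψ) - cb)) ∂(multivariateGaussian 0 Γ)) =
      (∫ ω : EuclideanSpace ℝ ι, exp (-U (ω + ψ)) * (f (ω + ψ) * g (ω + ψ)) ∂(multivariateGaussian 0 Γ)) - ca * (∫ ω : EuclideanSpace ℝ ι, exp (-U (ω
          + ψ)) * g (ω + ψ) ∂(multivariateGaussian 0 Γ)) - cb * (∫ ω : EuclideanSpace ℝ ι, exp (-U (ω + ψ)) * f (ω + ψ) ∂(multivariateGaussian 0 Γ)) +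
        ca * cb * (∫ ω : EuclideanSpace ℝ ι, exp (-U (ω + ψ)) ∂(multivariateGaussian 0 Γ)) := by
  have ifg := integrable_tilted_of_growth (p := fun φ => f φ * g φ) hΓ hΓop Y hUd (hfc.mul hgc) hκ₀ hκ₁ ha hτ hδ hθ1 hκθ hstab hU'b
    (fun φ => class_mul_abs_le hfb hgb φ) ψ
  have i_f := integrable_tilted_of_growth hΓ hΓop Y hUd hfc hκ₀ hκ₁ ha hτ hδ hθ1 hκθ hstab hU'b hfb ψ
  have i_g := integrable_tilted_of_growth hΓ hΓop Y hUd hgc hκ₀ hκ₁ ha hτ hδ hθ1 hκθ hstab hU'b hgb ψ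
  have i_1 : Integrable (fun ω : EuclideanSpace ℝ ι => exp (-U (ω + ψ))) (multivariateGaussian 0 Γ) := by
    have h1 := integrable_tilted_of_growth (p := fun _ => (1 : ℝ)) (Cp := 1) (n := 0) hΓ hΓop Y hUd continuous_const hκ₀ hκ₁ ha hτ hδ hθ1 hκθ
      hstab hU'b (fun φ => by rw [abs_one, pow_zero, mul_one]) ψ
    simpa only [mul_one] using h1
  have ee : ∀ ω : EuclideanSpace ℝ ι, exp (-U (ω + ψ)) * ((f (ω + ψ) - ca) * (g (ω + ψ) - cb)) =
      exp (-U (ω + ψ)) * (f (ω + ψ) * g (ω + ψ)) - ca * (exp (-U (ω + ψ)) * g (ω + ψ)) - cb * (exp (-U (ω + ψ)) * f (ω + ψ)) + ca * cb * exp (-U (ω +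
          ψ)) :=
    fun ω => by ring
  simp_rw [ee]
  rw [integral_add, integral_sub, integral_sub, integral_const_mul, integral_const_mul, integral_const_mul]
  · exact ifg
  · exact i_g.const_mul _
  · exact ifg.sub (i_g.const_mul _)
  · exact i_f.const_mul _
  · exact (ifg.sub (i_g.const_mul _)).sub (i_f.const_mul _)
  · exact i_1.const_mul _

/-- **Splitting a centred quadruple**: `∫eΠ⁴(fᵢ−cᵢ)` = the sixteen raw moments with signs `(−1)^{#constants}`. [folklore] -/
theorem split_centred_quad {f g h w : EuclideanSpace ℝ ι → ℝ} {Cf Cg Ch Cw : ℝ} {nf ng nh nw : ℕ} (hΓ : Γ.PosSemidef)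
    (hΓop : (γop • (1 : Matrix ι ι ℝ) - Γ).PosSemidef) (Y : Finset ι) (hUd : ∀ φ : EuclideanSpace ℝ ι, HasFDerivAt U (U' φ) φ)
    (hκ₀ : 0 ≤ κ₀) (hκ₁ : 0 ≤ κ₁) (ha : 0 ≤ a) (hτ : 0 < τ) (hδ : 0 < δ) (hθ1 : θ < 1) (hκθ : (2 * κ₀ * (1 + τ) + 4 * δ) * γop ≤ θ)
    (hstab : ∀ φ : EuclideanSpace ℝ ι, -(κ₀ * ∑ x ∈ Y, φ x ^ 2) ≤ U φ) (hU'b : ∀ φ : EuclideanSpace ℝ ι, ‖U' φ‖ ≤ κ₁ * (a + ∑ x ∈ Y, φ x ^ 2))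
    (hfc : Continuous f) (hfb : ∀ φ : EuclideanSpace ℝ ι, |f φ| ≤ Cf * (1 + ‖U' φ‖) ^ nf) (hgc : Continuous g) (hgb : ∀ φ : EuclideanSpace ℝ ι, |g φ|
        ≤ Cg * (1 + ‖U' φ‖) ^ ng)
    (hhc : Continuous h) (hhb : ∀ φ : EuclideanSpace ℝ ι, |h φ| ≤ Ch * (1 + ‖U' φ‖) ^ nh) (hwc : Continuous w) (hwb : ∀ φ : EuclideanSpace ℝ ι, |w φ|
        ≤ Cw * (1 + ‖U' φ‖) ^ nw)
    (ψ : EuclideanSpace ℝ ι) (ca cb cc cd : ℝ) :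
    (∫ ω : EuclideanSpace ℝ ι, exp (-U (ω + ψ)) * ((f (ω + ψ) - ca) * (g (ω + ψ) - cb) * (h (ω + ψ) - cc) * (w (ω + ψ) - cd)) ∂(multivariateGaussian
        0 Γ)) =
      (∫ ω : EuclideanSpace ℝ ι, exp (-U (ω + ψ)) * (f (ω + ψ) * g (ω + ψ) * h (ω + ψ) * w (ω + ψ)) ∂(multivariateGaussian 0 Γ)) -
        cd * (∫ ω : EuclideanSpace ℝ ι, exp (-U (ω + ψ)) * (f (ω + ψ) * g (ω + ψ) * h (ω + ψ)) ∂(multivariateGaussian 0 Γ)) -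
        cc * (∫ ω : EuclideanSpace ℝ ι, exp (-U (ω + ψ)) * (f (ω + ψ) * g (ω + ψ) * w (ω + ψ)) ∂(multivariateGaussian 0 Γ)) -
        cb * (∫ ω : EuclideanSpace ℝ ι, exp (-U (ω + ψ)) * (f (ω + ψ) * h (ω + ψ) * w (ω + ψ)) ∂(multivariateGaussian 0 Γ)) -
        ca * (∫ ω : EuclideanSpace ℝ ι, exp (-U (ω + ψ)) * (g (ω + ψ) * h (ω + ψ) * w (ω + ψ)) ∂(multivariateGaussian 0 Γ)) +
        cc * cd * (∫ ω : EuclideanSpace ℝ ι, exp (-U (ω + ψ)) * (f (ω + ψ) * g (ω + ψ)) ∂(multivariateGaussian 0 Γ)) +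
        cb * cd * (∫ ω : EuclideanSpace ℝ ι, exp (-U (ω + ψ)) * (f (ω + ψ) * h (ω + ψ)) ∂(multivariateGaussian 0 Γ)) +
        cb * cc * (∫ ω : EuclideanSpace ℝ ι, exp (-U (ω + ψ)) * (f (ω + ψ) * w (ω + ψ)) ∂(multivariateGaussian 0 Γ)) +
        ca * cd * (∫ ω : EuclideanSpace ℝ ι, exp (-U (ω + ψ)) * (g (ω + ψ) * h (ω + ψ)) ∂(multivariateGaussian 0 Γ)) +
        ca * cc * (∫ ω : EuclideanSpace ℝ ι, exp (-U (ω + ψ)) * (g (ω + ψ) * w (ω + ψ)) ∂(multivariateGaussian 0 Γ)) +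
        ca * cb * (∫ ω : EuclideanSpace ℝ ι, exp (-U (ω + ψ)) * (h (ω + ψ) * w (ω + ψ)) ∂(multivariateGaussian 0 Γ)) -
        cb * cc * cd * (∫ ω : EuclideanSpace ℝ ι, exp (-U (ω + ψ)) * f (ω + ψ) ∂(multivariateGaussian 0 Γ)) -
        ca * cc * cd * (∫ ω : EuclideanSpace ℝ ι, exp (-U (ω + ψ)) * g (ω + ψ) ∂(multivariateGaussian 0 Γ)) -
        ca * cb * cd * (∫ ω : EuclideanSpace ℝ ι, exp (-U (ω + ψ)) * h (ω + ψ) ∂(multivariateGaussian 0 Γ)) -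
        ca * cb * cc * (∫ ω : EuclideanSpace ℝ ι, exp (-U (ω + ψ)) * w (ω + ψ) ∂(multivariateGaussian 0 Γ)) +
        ca * cb * cc * cd * (∫ ω : EuclideanSpace ℝ ι, exp (-U (ω + ψ)) ∂(multivariateGaussian 0 Γ)) := by
  have i_fghw := integrable_tilted_of_growth (p := fun φ => f φ * g φ * h φ * w φ) hΓ hΓop Y hUd (((hfc.mul hgc).mul hhc).mul hwc) hκ₀ hκ₁ ha hτ hδ
      hθ1 hκθ hstab hU'b
    (fun φ => class_mul_abs_le (fun φ => class_mul_abs_le (fun φ => class_mul_abs_le hfb hgb φ) hhb φ) hwb φ) ψ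
  have i_fgh := integrable_tilted_of_growth (p := fun φ => f φ * g φ * h φ) hΓ hΓop Y hUd ((hfc.mul hgc).mul hhc) hκ₀ hκ₁ ha hτ hδ hθ1 hκθ hstab hU'b
    (fun φ => class_mul_abs_le (fun φ => class_mul_abs_le hfb hgb φ) hhb φ) ψ
  have i_fgw := integrable_tilted_of_growth (p := fun φ => f φ * g φ * w φ) hΓ hΓop Y hUd ((hfc.mul hgc).mul hwc) hκ₀ hκ₁ ha hτ hδ hθ1 hκθ hstab hU'b
    (fun φ => class_mul_abs_le (fun φ => class_mul_abs_le hfb hgb φ) hwb φ) ψ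
  have i_fhw := integrable_tilted_of_growth (p := fun φ => f φ * h φ * w φ) hΓ hΓop Y hUd ((hfc.mul hhc).mul hwc) hκ₀ hκ₁ ha hτ hδ hθ1 hκθ hstab hU'b
    (fun φ => class_mul_abs_le (fun φ => class_mul_abs_le hfb hhb φ) hwb φ) ψ
  have i_ghw := integrable_tilted_of_growth (p := fun φ => g φ * h φ * w φ) hΓ hΓop Y hUd ((hgc.mul hhc).mul hwc) hκ₀ hκ₁ ha hτ hδ hθ1 hκθ hstab hU'b
    (fun φ => class_mul_abs_le (fun φ => class_mul_abs_le hgb hhb φ) hwb φ) ψ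
  have i_fg := integrable_tilted_of_growth (p := fun φ => f φ * g φ) hΓ hΓop Y hUd (hfc.mul hgc) hκ₀ hκ₁ ha hτ hδ hθ1 hκθ hstab hU'b
    (fun φ => class_mul_abs_le hfb hgb φ) ψ
  have i_fh := integrable_tilted_of_growth (p := fun φ => f φ * h φ) hΓ hΓop Y hUd (hfc.mul hhc) hκ₀ hκ₁ ha hτ hδ hθ1 hκθ hstab hU'b
    (fun φ => class_mul_abs_le hfb hhb φ) ψ
  have i_fw := integrable_tilted_of_growth (p := fun φ => f φ * w φ) hΓ hΓop Y hUd (hfc.mul hwc) hκ₀ hκ₁ ha hτ hδ hθ1 hκθ hstab hU'b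
    (fun φ => class_mul_abs_le hfb hwb φ) ψ
  have i_gh := integrable_tilted_of_growth (p := fun φ => g φ * h φ) hΓ hΓop Y hUd (hgc.mul hhc) hκ₀ hκ₁ ha hτ hδ hθ1 hκθ hstab hU'b
    (fun φ => class_mul_abs_le hgb hhb φ) ψ
  have i_gw := integrable_tilted_of_growth (p := fun φ => g φ * w φ) hΓ hΓop Y hUd (hgc.mul hwc) hκ₀ hκ₁ ha hτ hδ hθ1 hκθ hstab hU'b
    (fun φ => class_mul_abs_le hgb hwb φ) ψ
  have i_hw := integrable_tilted_of_growth (p := fun φ => h φ * w φ) hΓ hΓop Y hUd (hhc.mul hwc) hκ₀ hκ₁ ha hτ hδ hθ1 hκθ hstab hU'b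
    (fun φ => class_mul_abs_le hhb hwb φ) ψ
  have i_f := integrable_tilted_of_growth hΓ hΓop Y hUd hfc hκ₀ hκ₁ ha hτ hδ hθ1 hκθ hstab hU'b hfb ψ
  have i_g := integrable_tilted_of_growth hΓ hΓop Y hUd hgc hκ₀ hκ₁ ha hτ hδ hθ1 hκθ hstab hU'b hgb ψ
  have i_h := integrable_tilted_of_growth hΓ hΓop Y hUd hhc hκ₀ hκ₁ ha hτ hδ hθ1 hκθ hstab hU'b hhb ψ
  have i_w := integrable_tilted_of_growth hΓ hΓop Y hUd hwc hκ₀ hκ₁ ha hτ hδ hθ1 hκθ hstab hU'b hwb ψ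
  have i_one : Integrable (fun ω : EuclideanSpace ℝ ι => exp (-U (ω + ψ))) (multivariateGaussian 0 Γ) := by
    have h1 := integrable_tilted_of_growth (p := fun _ => (1 : ℝ)) (Cp := 1) (n := 0) hΓ hΓop Y hUd continuous_const hκ₀ hκ₁ ha hτ hδ hθ1 hκθ
      hstab hU'b (fun φ => by rw [abs_one, pow_zero, mul_one]) ψ
    simpa only [mul_one] using h1
  have ee : ∀ ω : EuclideanSpace ℝ ι, exp (-U (ω + ψ)) * ((f (ω + ψ) - ca) * (g (ω + ψ) - cb) * (h (ω + ψ) - cc) * (w (ω + ψ) - cd)) =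
      (exp (-U (ω + ψ)) * (f (ω + ψ) * g (ω + ψ) * h (ω + ψ) * w (ω + ψ))) - cd * (exp (-U (ω + ψ)) * (f (ω + ψ) * g (ω + ψ) * h (ω + ψ))) - cc *
          (exp (-U (ω + ψ)) * (f (ω + ψ) * g (ω + ψ) * w (ω + ψ))) - cb * (exp (-U (ω + ψ)) * (f (ω + ψ) * h (ω + ψ) * w (ω + ψ))) - ca * (exp (-U (ω
          + ψ)) * (g (ω + ψ) * h (ω + ψ) * w (ω + ψ))) + cc * cd * (exp (-U (ω + ψ)) * (f (ω + ψ) * g (ω + ψ))) + cb * cd * (exp (-U (ω + ψ)) * (f (ω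
          + ψ) * h (ω + ψ))) + cb * cc * (exp (-U (ω + ψ)) * (f (ω + ψ) * w (ω + ψ))) + ca * cd * (exp (-U (ω + ψ)) * (g (ω + ψ) * h (ω + ψ))) + ca *
          cc * (exp (-U (ω + ψ)) * (g (ω + ψ) * w (ω + ψ))) + ca * cb * (exp (-U (ω + ψ)) * (h (ω + ψ) * w (ω + ψ))) - cb * cc * cd * (exp (-U (ω +
          ψ)) * f (ω + ψ)) - ca * cc * cd * (exp (-U (ω + ψ)) * g (ω + ψ)) - ca * cb * cd * (exp (-U (ω + ψ)) * h (ω + ψ)) - ca * cb * cc * (exp (-U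
          (ω + ψ)) * w (ω + ψ)) + ca * cb * cc * cd * exp (-U (ω + ψ)) := fun ω => by ring
  simp_rw [ee]
  rw [integral_add, integral_sub, integral_sub, integral_sub, integral_sub, integral_add, integral_add, integral_add, integral_add, integral_add,
      integral_add, integral_sub, integral_sub, integral_sub, integral_sub, integral_const_mul, integral_const_mul, integral_const_mul,
      integral_const_mul, integral_const_mul, integral_const_mul, integral_const_mul, integral_const_mul, integral_const_mul, integral_const_mul,
      integral_const_mul, integral_const_mul, integral_const_mul, integral_const_mul, integral_const_mul]
  · exact i_fghw
  · exact (i_fgh.const_mul _)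
  · exact (i_fghw.sub (i_fgh.const_mul _))
  · exact (i_fgw.const_mul _)
  · exact ((i_fghw.sub (i_fgh.const_mul _)).sub (i_fgw.const_mul _))
  · exact (i_fhw.const_mul _)
  · exact (((i_fghw.sub (i_fgh.const_mul _)).sub (i_fgw.const_mul _)).sub (i_fhw.const_mul _))
  · exact (i_ghw.const_mul _)
  · exact ((((i_fghw.sub (i_fgh.const_mul _)).sub (i_fgw.const_mul _)).sub (i_fhw.const_mul _)).sub (i_ghw.const_mul _))
  · exact (i_fg.const_mul _)
  · exact (((((i_fghw.sub (i_fgh.const_mul _)).sub (i_fgw.const_mul _)).sub (i_fhw.const_mul _)).sub (i_ghw.const_mul _)).add (i_fg.const_mul _))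
  · exact (i_fh.const_mul _)
  · exact ((((((i_fghw.sub (i_fgh.const_mul _)).sub (i_fgw.const_mul _)).sub (i_fhw.const_mul _)).sub (i_ghw.const_mul _)).add (i_fg.const_mul
      _)).add (i_fh.const_mul _))
  · exact (i_fw.const_mul _)
  · exact (((((((i_fghw.sub (i_fgh.const_mul _)).sub (i_fgw.const_mul _)).sub (i_fhw.const_mul _)).sub (i_ghw.const_mul _)).add (i_fg.const_mul
      _)).add (i_fh.const_mul _)).add (i_fw.const_mul _))
  · exact (i_gh.const_mul _)
  · exact ((((((((i_fghw.sub (i_fgh.const_mul _)).sub (i_fgw.const_mul _)).sub (i_fhw.const_mul _)).sub (i_ghw.const_mul _)).add (i_fg.const_mul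
      _)).add (i_fh.const_mul _)).add (i_fw.const_mul _)).add (i_gh.const_mul _))
  · exact (i_gw.const_mul _)
  · exact (((((((((i_fghw.sub (i_fgh.const_mul _)).sub (i_fgw.const_mul _)).sub (i_fhw.const_mul _)).sub (i_ghw.const_mul _)).add (i_fg.const_mul
      _)).add (i_fh.const_mul _)).add (i_fw.const_mul _)).add (i_gh.const_mul _)).add (i_gw.const_mul _))
  · exact (i_hw.const_mul _)
  · exact ((((((((((i_fghw.sub (i_fgh.const_mul _)).sub (i_fgw.const_mul _)).sub (i_fhw.const_mul _)).sub (i_ghw.const_mul _)).add (i_fg.const_mul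
      _)).add (i_fh.const_mul _)).add (i_fw.const_mul _)).add (i_gh.const_mul _)).add (i_gw.const_mul _)).add (i_hw.const_mul _))
  · exact (i_f.const_mul _)
  · exact (((((((((((i_fghw.sub (i_fgh.const_mul _)).sub (i_fgw.const_mul _)).sub (i_fhw.const_mul _)).sub (i_ghw.const_mul _)).add (i_fg.const_mul
      _)).add (i_fh.const_mul _)).add (i_fw.const_mul _)).add (i_gh.const_mul _)).add (i_gw.const_mul _)).add (i_hw.const_mul _)).sub (i_f.const_mul
      _))
  · exact (i_g.const_mul _)
  · exact ((((((((((((i_fghw.sub (i_fgh.const_mul _)).sub (i_fgw.const_mul _)).sub (i_fhw.const_mul _)).sub (i_ghw.const_mul _)).add (i_fg.const_mul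
      _)).add (i_fh.const_mul _)).add (i_fw.const_mul _)).add (i_gh.const_mul _)).add (i_gw.const_mul _)).add (i_hw.const_mul _)).sub (i_f.const_mul
      _)).sub (i_g.const_mul _))
  · exact (i_h.const_mul _)
  · exact (((((((((((((i_fghw.sub (i_fgh.const_mul _)).sub (i_fgw.const_mul _)).sub (i_fhw.const_mul _)).sub (i_ghw.const_mul _)).add (i_fg.const_mul
      _)).add (i_fh.const_mul _)).add (i_fw.const_mul _)).add (i_gh.const_mul _)).add (i_gw.const_mul _)).add (i_hw.const_mul _)).sub (i_f.const_mul
      _)).sub (i_g.const_mul _)).sub (i_h.const_mul _))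
  · exact (i_w.const_mul _)
  · exact ((((((((((((((i_fghw.sub (i_fgh.const_mul _)).sub (i_fgw.const_mul _)).sub (i_fhw.const_mul _)).sub (i_ghw.const_mul _)).add
      (i_fg.const_mul _)).add (i_fh.const_mul _)).add (i_fw.const_mul _)).add (i_gh.const_mul _)).add (i_gw.const_mul _)).add (i_hw.const_mul _)).sub
      (i_f.const_mul _)).sub (i_g.const_mul _)).sub (i_h.const_mul _)).sub (i_w.const_mul _))
  · exact (i_one.const_mul _)

/-! ## Toy -/

/-- Toy (the sign pattern of the quadruple split at `f = g = h = w = 0`): `(0−a)(0−b)(0−c)(0−d) = abcd`. -/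
example (a b c d : ℝ) : (0 - a) * (0 - b) * (0 - c) * (0 - d) = a * b * c * d := by ring

end Summit.QuantumFields.BalabanUV.T4Continuum.NE7b.SupTiltedCentredSplits

end
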